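import Summits.QuantumFields.BalabanUV.Beta.GAN24.CombContactKernelCells

/-!
# The (III′) Wilson INSERTION DEFECT — conjugated cubic push minus (E) dressed cubic push — is three explicit one-gauge cells whose gauge is the OWNER's
# face term `PsiFace` ALONE (generic `d`, any `Lc ≥ 1`, every `m k`)

NOT IN PRINT — OUR BOOKKEEPING (road-P2 = `b2b-balaban-gan24-p2` gen 56, 2026-08-25; row G-an2-4 ∕ (CONV-C), the (α-0) chain at row D1's literal
OF RECORD (III′) `JsB12CombShSym`; [folklore] composition BY NAME; 0 `def`, 0 cite, 0 `def … : Prop`, 0 `sorry`).  Weight 0.  NEVER «G-an2-4 closed» as (CONV-C);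
NOT D1, NOT BetaPertH, NOT continuum, NOT Clay; NO campaign opened (an2 W-4).

The LEG-SIDE companion of M.55 `CombWilsonInsertionDefect` (table-side discrete Duhamel form) over M.59 `CombContactKernelCells.combLegChain_sub_legChain` (the kernel form
of the OWNER gan24-p1 g47's decomposition `CombLegChainGauge.legAct_legChain_psiLeg_eq`: conjugated − dressed = `(μ,z,κ,u) ↦ dz (PsiFace r ρ Lc m k (delta1 μ z)) κ u`) and
leaf-01 g58's `ContactKernelCells.contact_ff_eq_cells` (generic `d`, summable class):
* §1 **`insertion_combLegChain_ff_eq_cells (hr hrr) (m k κ′ u′ x′ z′ α β)`** — with the conjugated chains `T′ = legChain (fun j ↦ legComp ψ♭ R_j) m k` in the three «E» slots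
  and the (E) dressed chains `T = legChain R m k` in the three «B» slots, every field entry of `push₃ T′ T′ T′ (wilsonA d) κ′ u′ − push₃ T T T (wilsonA d) κ′ u′` equals
  `[LEFT cell: T₃ = T′ β z′, T₁ = T′ κ′ u′, ψ = Φ α x′] − [RIGHT cell: T₃ = T α x′, T₁ = T′ κ′ u′, ψ = Φ β z′] + [TABLE cell: TR = T β z′, TL = T α x′, ψ = Φ κ′ u′]`,
  `Φ μ z := PsiFace r ρ Lc m k (delta1 μ z)` — NO `Psi`, NO `bmGaugeAt`: the defect of the (III′) Wilson row against the (E) one is carried by the inter-block FACE gauges only.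
  GENERIC `d` and ANY `Lc ≥ 1`: both leg classes are `LegL1` (the OWNER's `exists_legL1_legChain_psiLeg ∕ exists_legL1_legChain`), no envelope needed.
* §2 `insertion_combLegChain_ff_eq_cells_zero (k)` — the same at `m = 0` (the slots of M.52's `exists_hS0_combWilson_of_contact_sub` insertion-defect hypothesis, whose legs are
  `legChain _ 0 k`).
What is LEFT for the (III′) Wilson row by this route (located, zero weight): leaf-02's cell bounds `ContactOneGaugeCellTable.abs_cell_le' ∕ abs_cellIdx_le'` fed with the
OWNER's `PsiFace` words (INTENT-2 `CombLegFaceSawtoothBlockL1`: block-ℓ¹ of `dz PsiFace (single μ z)`; next `CombLegBlockL1Envelope`) and the (E) ∕ conjugated leg envelopes.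
Discharges NOTHING; NO estimate; NO value ∕ rate of Bałaban's tables.
-/

noncomputable section

open Finset
open scoped BigOperators
open Literature.MathematicalPhysics.QuantumFieldTheory
open Literature.MathematicalPhysics.QuantumFieldTheory.Balaban1983to89
open Literature.MathematicalPhysics.QuantumFieldTheory.Balaban1983to89.Beta
open StepJetData (wilsonA)
open AffineAveraging (Form1 Site box toSite dz curv curvAdj)
open B6BondElimination (unitVec)
open KKTFluctuationKernel (delta1)
open Summit.QuantumFields.BalabanUV.Beta.SymCorrectorKernel (psiKS)
open Summit.QuantumFields.BalabanUV.Beta.GAN24.Push4 (legComp)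
open Summit.QuantumFields.BalabanUV.Beta.GAN24.Push4Iter (legChain)
open Summit.QuantumFields.BalabanUV.Beta.GAN24.Push3 (push₃)
open Summit.QuantumFields.BalabanUV.Beta.GAN24.RespStepBmDecompLegs (LegL1)
open Summit.QuantumFields.BalabanUV.Beta.GAN24.RespStepBmDecompExact (respStepBmSeq)
open Summit.QuantumFields.BalabanUV.Beta.GAN24.ContactKernelCells (contact_ff_eq_cells)
open Summit.QuantumFields.BalabanUV.Beta.GAN24.CombLegChainGauge (PsiFace exists_legL1_legChain exists_legL1_legChain_psiLeg)
open Summit.QuantumFields.BalabanUV.Beta.GAN24.CombContactKernelCells (combLegChain_sub_legChain)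

namespace Summit.QuantumFields.BalabanUV.Beta.GAN24.CombWilsonInsertionCells

variable {d : ℕ} {Lc : ℕ} [NeZero Lc] {r : Fin (d + 1) → ℕ} (hr : r ∈ box (d + 1) Lc) {rr : Fin (d + 1) → ℕ} (hrr : rr ∈ box (d + 1) Lc)
include hr hrr

/-! ## §1 The insertion defect of the cubic Wilson push is three one-gauge cells with the face gauge alone -/

/-- NOT IN PRINT; OUR BOOKKEEPING ([folklore]; leaf-01's `contact_ff_eq_cells` on the OWNER's `LegL1` classes with M.59's kernel form).  **THE (III′) WILSON INSERTION DEFECT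
IS THREE EXPLICIT ONE-GAUGE CELLS WHOSE GAUGE IS THE FACE TERM ALONE** (generic `d`, any `Lc ≥ 1`, roots `r rr ∈ box`, every `m k`): with `T′ = legChain (fun j ↦ legComp ψ♭ R_j) m k`,
`T = legChain R m k` (`R = respStepBmSeq (toSite rr) Lc`) and `Φ μ z := PsiFace r (toSite rr) Lc m k (delta1 μ z)`, every field entry of
`push₃ T′ T′ T′ (wilsonA d) κ′ u′ − push₃ T T T (wilsonA d) κ′ u′` is `[LEFT cell (T′ β z′, T′ κ′ u′, Φ α x′)] − [RIGHT cell (T α x′, T′ κ′ u′, Φ β z′)] + [TABLE cell (T β z′, T α x′, Φ κ′ u′)]`. -/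
theorem insertion_combLegChain_ff_eq_cells (m k : ℕ) (κ' : Fin (d + 1)) (u' x' z' : Site (d + 1)) (α β : Fin (d + 1)) :
    push₃ (legChain (fun j => legComp (fun α x κ u => psiKS r Lc u x (Sum.inl κ) (Sum.inl α)) (respStepBmSeq (d := d) (toSite rr) Lc j)) m k)
        (legChain (fun j => legComp (fun α x κ u => psiKS r Lc u x (Sum.inl κ) (Sum.inl α)) (respStepBmSeq (d := d) (toSite rr) Lc j)) m k)
        (legChain (fun j => legComp (fun α x κ u => psiKS r Lc u x (Sum.inl κ) (Sum.inl α)) (respStepBmSeq (d := d) (toSite rr) Lc j)) m k)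
        (wilsonA d) κ' u' x' z' (Sum.inl α) (Sum.inl β)
      - push₃ (legChain (respStepBmSeq (d := d) (toSite rr) Lc) m k) (legChain (respStepBmSeq (d := d) (toSite rr) Lc) m k)
        (legChain (respStepBmSeq (d := d) (toSite rr) Lc) m k) (wilsonA d) κ' u' x' z' (Sum.inl α) (Sum.inl β)
      = (∑' z, ∑ b, legChain (fun j => legComp (fun α x κ u => psiKS r Lc u x (Sum.inl κ) (Sum.inl α)) (respStepBmSeq (d := d) (toSite rr) Lc j)) m k β z' b z *
            ∑' u, ∑ κ, legChain (fun j => legComp (fun α x κ u => psiKS r Lc u x (Sum.inl κ) (Sum.inl α)) (respStepBmSeq (d := d) (toSite rr) Lc j)) m k κ' u' κ u *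
              ((1 / 2 : ℝ) *
                (PsiFace r (toSite rr) Lc m k (delta1 α x') (u + unitVec κ)
                  - (PsiFace r (toSite rr) Lc m k (delta1 α x') z + PsiFace r (toSite rr) Lc m k (delta1 α x') (z + unitVec b)) / 2) *
                curvAdj (curv (delta1 κ u)) b z))
        - (∑' x, ∑ a, legChain (respStepBmSeq (d := d) (toSite rr) Lc) m k α x' a x *
            ∑' u, ∑ κ, legChain (fun j => legComp (fun α x κ u => psiKS r Lc u x (Sum.inl κ) (Sum.inl α)) (respStepBmSeq (d := d) (toSite rr) Lc j)) m k κ' u' κ u *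
              ((1 / 2 : ℝ) *
                (PsiFace r (toSite rr) Lc m k (delta1 β z') (u + unitVec κ)
                  - (PsiFace r (toSite rr) Lc m k (delta1 β z') x + PsiFace r (toSite rr) Lc m k (delta1 β z') (x + unitVec a)) / 2) *
                curvAdj (curv (delta1 κ u)) a x))
        + (∑' z, ∑ b, legChain (respStepBmSeq (d := d) (toSite rr) Lc) m k β z' b z *
            ∑' x, ∑ a, legChain (respStepBmSeq (d := d) (toSite rr) Lc) m k α x' a x *
              ((1 / 2 : ℝ) * (PsiFace r (toSite rr) Lc m k (delta1 κ' u') z - PsiFace r (toSite rr) Lc m k (delta1 κ' u') x) *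
                curvAdj (curv (delta1 b z)) a x)) := by
  -- both leg classes are `LegL1`: bounded with summable fine slices
  obtain ⟨CT', TT', hT'⟩ := exists_legL1_legChain_psiLeg (d := d) hr hrr m k
  obtain ⟨CT, TT, hT⟩ := exists_legL1_legChain (d := d) hrr m k
  have hTa' : ∀ μ y κ u, |legChain (fun j => legComp (fun α x κ u => psiKS r Lc u x (Sum.inl κ) (Sum.inl α)) (respStepBmSeq (d := d) (toSite rr) Lc j)) m k μ y κ u| ≤ CT' :=
    fun μ y κ u => hT'.abs_le μ y κ u
  have hTs' : ∀ μ y κ, Summable fun u => legChain (fun j => legComp (fun α x κ u => psiKS r Lc u x (Sum.inl κ) (Sum.inl α)) (respStepBmSeq (d := d) (toSite rr) Lc j)) m k μ y κ u :=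
    fun μ y κ => (hT'.2 μ y κ).1
  have hTa : ∀ μ y κ u, |legChain (respStepBmSeq (d := d) (toSite rr) Lc) m k μ y κ u| ≤ CT := fun μ y κ u => hT.abs_le μ y κ u
  have hTs : ∀ μ y κ, Summable fun u => legChain (respStepBmSeq (d := d) (toSite rr) Lc) m k μ y κ u := fun μ y κ => (hT.2 μ y κ).1
  exact contact_ff_eq_cells hTa' hTs' hTa hTs hTa' hTs' hTa hTs hTa' hTa
    (combLegChain_sub_legChain hr hrr m k) (combLegChain_sub_legChain hr hrr m k) (combLegChain_sub_legChain hr hrr m k) κ' u' x' z' α β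

/-! ## §2 The slots of the (III′) Wilson row: base level `0` -/

/-- NOT IN PRINT; OUR BOOKKEEPING (§1 at `m = 0`).  **THE INSERTION DEFECT OF THE (III′) WILSON LINEAGE'S LEGS `legChain _ 0 k`** — the object of M.52
`CombWilsonSectorRow.exists_hS0_combWilson_of_contact_sub`'s insertion-defect hypothesis and of M.55 `CombWilsonInsertionDefect`, read as three face-gauge cells. -/
theorem insertion_combLegChain_ff_eq_cells_zero (k : ℕ) (κ' : Fin (d + 1)) (u' x' z' : Site (d + 1)) (α β : Fin (d + 1)) :
    push₃ (legChain (fun j => legComp (fun α x κ u => psiKS r Lc u x (Sum.inl κ) (Sum.inl α)) (respStepBmSeq (d := d) (toSite rr) Lc j)) 0 k)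
        (legChain (fun j => legComp (fun α x κ u => psiKS r Lc u x (Sum.inl κ) (Sum.inl α)) (respStepBmSeq (d := d) (toSite rr) Lc j)) 0 k)
        (legChain (fun j => legComp (fun α x κ u => psiKS r Lc u x (Sum.inl κ) (Sum.inl α)) (respStepBmSeq (d := d) (toSite rr) Lc j)) 0 k)
        (wilsonA d) κ' u' x' z' (Sum.inl α) (Sum.inl β)
      - push₃ (legChain (respStepBmSeq (d := d) (toSite rr) Lc) 0 k) (legChain (respStepBmSeq (d := d) (toSite rr) Lc) 0 k)
        (legChain (respStepBmSeq (d := d) (toSite rr) Lc) 0 k) (wilsonA d) κ' u' x' z' (Sum.inl α) (Sum.inl β)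
      = (∑' z, ∑ b, legChain (fun j => legComp (fun α x κ u => psiKS r Lc u x (Sum.inl κ) (Sum.inl α)) (respStepBmSeq (d := d) (toSite rr) Lc j)) 0 k β z' b z *
            ∑' u, ∑ κ, legChain (fun j => legComp (fun α x κ u => psiKS r Lc u x (Sum.inl κ) (Sum.inl α)) (respStepBmSeq (d := d) (toSite rr) Lc j)) 0 k κ' u' κ u *
              ((1 / 2 : ℝ) *
                (PsiFace r (toSite rr) Lc 0 k (delta1 α x') (u + unitVec κ)
                  - (PsiFace r (toSite rr) Lc 0 k (delta1 α x') z + PsiFace r (toSite rr) Lc 0 k (delta1 α x') (z + unitVec b)) / 2) *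
                curvAdj (curv (delta1 κ u)) b z))
        - (∑' x, ∑ a, legChain (respStepBmSeq (d := d) (toSite rr) Lc) 0 k α x' a x *
            ∑' u, ∑ κ, legChain (fun j => legComp (fun α x κ u => psiKS r Lc u x (Sum.inl κ) (Sum.inl α)) (respStepBmSeq (d := d) (toSite rr) Lc j)) 0 k κ' u' κ u *
              ((1 / 2 : ℝ) *
                (PsiFace r (toSite rr) Lc 0 k (delta1 β z') (u + unitVec κ)
                  - (PsiFace r (toSite rr) Lc 0 k (delta1 β z') x + PsiFace r (toSite rr) Lc 0 k (delta1 β z') (x + unitVec a)) / 2) *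
                curvAdj (curv (delta1 κ u)) a x))
        + (∑' z, ∑ b, legChain (respStepBmSeq (d := d) (toSite rr) Lc) 0 k β z' b z *
            ∑' x, ∑ a, legChain (respStepBmSeq (d := d) (toSite rr) Lc) 0 k α x' a x *
              ((1 / 2 : ℝ) * (PsiFace r (toSite rr) Lc 0 k (delta1 κ' u') z - PsiFace r (toSite rr) Lc 0 k (delta1 κ' u') x) *
                curvAdj (curv (delta1 b z)) a x)) :=
  insertion_combLegChain_ff_eq_cells hr hrr 0 k κ' u' x' z' α β

end Summit.QuantumFields.BalabanUV.Beta.GAN24.CombWilsonInsertionCells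

end
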